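import Mathlib.Analysis.SpecialFunctions.Complex.Circle
import Mathlib.Topology.Instances.AddCircle.Defs
import Mathlib.Topology.Order.IntermediateValue
import Literature.AlgebraicGeometry.Frobenioids.CircleOpens
import HarnessLib

/-!
# Frobenioids II, Lemma 3.2: connected open subsets of `S¹` are arcs

Mochizuki, *The geometry of Frobenioids II*, Kyushu J. Math. **62** (2008) 401–460, §3, Lemma 3.2
pp. 25–27 [cite: MochizukiFrdII2008, Lem 3.2 pp.25-27]. Infrastructure for the discharge of the
named facts of `CircleOpens.lean` (abc-iut-L1-t4): the printed proofs of (ii), (iv)–(ix) argue with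
arcs and arc length ("the length of `B \ A₁`", p. 26). This file PROVES the structure statement they
rest on: a [nonempty] connected open `A ⊊ S¹` is the image `exp(i·(c, d))` of an open interval
with `0 < d - c ≤ 2π` (`exists_eq_exp_image_Ioo`), via Mathlib's chart
`AddCircle.equivIco` (continuous off one point) and `AddCircle (2π) ≃ₜ Circle`; plus the converse
facts (`isOpen_exp_image`, `isConnected_exp_image_Ioo`) and the behaviour of arcs under the maps
of Lemma 3.2 (translations, `φ_n`). No item of Lemma 3.2 is restated here.
-/

namespace Literature.AlgebraicGeometry.Frobenioids

open Set Function Topology Real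
open scoped Pointwise

noncomputable section

namespace CircleOpens

/-- A nonempty bounded open connected subset of `ℝ` is the open interval between its infimum and
its supremum (adapted from the tree's `Literature/Topology/FourManifolds/PlanarSeams.lean`).
[cite: MochizukiFrdII2008, Lem 3.2 p.25] -/
private theorem eq_Ioo_of_isOpen_isConnected {c : Set ℝ} (hc : IsOpen c) (hconn : IsConnected c)
    (hb : BddBelow c) (ha : BddAbove c) : c = Ioo (sInf c) (sSup c) := by
  have hoc : OrdConnected c := isPreconnected_iff_ordConnected.1 hconn.isPreconnected
  apply Subset.antisymm
  · intro x hx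
    refine ⟨lt_of_le_of_ne (csInf_le hb hx) fun h => ?_,
      lt_of_le_of_ne (le_csSup ha hx) fun h => ?_⟩
    · obtain ⟨ε, hε, hball⟩ := Metric.isOpen_iff.1 hc x hx
      have hmem : x - ε / 2 ∈ Metric.ball x ε := by
        rw [Metric.mem_ball, Real.dist_eq, abs_lt]; constructor <;> linarith
      have := csInf_le hb (hball hmem)
      linarith
    · obtain ⟨ε, hε, hball⟩ := Metric.isOpen_iff.1 hc x hx
      have hmem : x + ε / 2 ∈ Metric.ball x ε := by
        rw [Metric.mem_ball, Real.dist_eq, abs_lt]; constructor <;> linarith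
      have := le_csSup ha (hball hmem)
      linarith
  · intro y hy
    obtain ⟨a, hac, hay⟩ := exists_lt_of_csInf_lt hconn.nonempty hy.1
    obtain ⟨b, hbc, hyb⟩ := exists_lt_of_lt_csSup hconn.nonempty hy.2
    exact hoc.out hac hbc ⟨hay.le, hyb.le⟩

/-! ### The chart `S¹ \ {exp(ia₀)} → (a₀, a₀ + 2π)` -/

/-- The lift `S¹ → [a₀, a₀ + 2π)` of the covering `exp`, read through Mathlib's `AddCircle.equivIco`.
[cite: MochizukiFrdII2008, Lem 3.2 p.25] -/
def liftIco (a₀ : ℝ) (z : Circle) : ℝ :=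
  haveI : Fact (0 < 2 * π) := ⟨two_pi_pos⟩
  ((AddCircle.equivIco (2 * π) a₀ (AddCircle.homeomorphCircle'.symm z) : ℝ))

/-- The lift takes values in `[a₀, a₀ + 2π)`. [cite: MochizukiFrdII2008, Lem 3.2 p.25] -/
theorem liftIco_mem (a₀ : ℝ) (z : Circle) : liftIco a₀ z ∈ Ico a₀ (a₀ + 2 * π) :=
  haveI : Fact (0 < 2 * π) := ⟨two_pi_pos⟩
  (AddCircle.equivIco (2 * π) a₀ (AddCircle.homeomorphCircle'.symm z)).2

/-- `exp` of the lift is the identity. [cite: MochizukiFrdII2008, Lem 3.2 p.25] -/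
theorem exp_liftIco (a₀ : ℝ) (z : Circle) : Circle.exp (liftIco a₀ z) = z := by
  haveI : Fact (0 < 2 * π) := ⟨two_pi_pos⟩
  have h1 : ((AddCircle.equivIco (2 * π) a₀ (AddCircle.homeomorphCircle'.symm z) : ℝ) :
      AddCircle (2 * π)) = AddCircle.homeomorphCircle'.symm z := AddCircle.coe_equivIco
  rw [liftIco, ← AddCircle.homeomorphCircle'_apply_mk, h1]
  exact AddCircle.homeomorphCircle'.apply_symm_apply z

/-- The lift of `exp x` for `x ∈ [a₀, a₀ + 2π)` is `x`. [cite: MochizukiFrdII2008, Lem 3.2 p.25] -/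
theorem liftIco_exp {a₀ x : ℝ} (hx : x ∈ Ico a₀ (a₀ + 2 * π)) : liftIco a₀ (Circle.exp x) = x := by
  haveI : Fact (0 < 2 * π) := ⟨two_pi_pos⟩
  have : AddCircle.homeomorphCircle'.symm (Circle.exp x) = (x : AddCircle (2 * π)) := by
    rw [Homeomorph.symm_apply_eq]
    exact (AddCircle.homeomorphCircle'_apply_mk x).symm
  rw [liftIco, this, AddCircle.equivIco_coe_of_mem hx]

/-- The lift is continuous away from `exp(ia₀)`. [cite: MochizukiFrdII2008, Lem 3.2 p.25] -/
theorem continuousAt_liftIco {a₀ : ℝ} {z : Circle} (hz : z ≠ Circle.exp a₀) :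
    ContinuousAt (liftIco a₀) z := by
  haveI : Fact (0 < 2 * π) := ⟨two_pi_pos⟩
  have hz' : AddCircle.homeomorphCircle'.symm z ≠ ((a₀ : ℝ) : AddCircle (2 * π)) := by
    intro e
    apply hz
    rw [← AddCircle.homeomorphCircle'_apply_mk, ← e, Homeomorph.apply_symm_apply]
  exact (continuous_subtype_val.continuousAt.comp (AddCircle.continuousAt_equivIco (2 * π) a₀ hz')).comp
    AddCircle.homeomorphCircle'.symm.continuous.continuousAt

/-- `exp(i·(a₀, a₀ + 2π)) = S¹ \ {exp(ia₀)}`. [cite: MochizukiFrdII2008, Lem 3.2 p.25] -/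
theorem exp_image_Ioo_eq_compl (a₀ : ℝ) :
    Circle.exp '' Ioo a₀ (a₀ + 2 * π) = {Circle.exp a₀}ᶜ := by
  ext z
  constructor
  · rintro ⟨x, hx, rfl⟩ (e : Circle.exp x = Circle.exp a₀)
    have := Circle.exp_injOn_Ico (a := a₀) (b := a₀ + 2 * π) (by linarith)
      (Ioo_subset_Ico_self hx) ⟨le_rfl, by linarith [two_pi_pos]⟩ e
    exact hx.1.ne' this
  · intro hz
    refine ⟨liftIco a₀ z, ⟨lt_of_le_of_ne (liftIco_mem a₀ z).1 ?_, (liftIco_mem a₀ z).2⟩,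
      exp_liftIco a₀ z⟩
    intro e
    apply hz
    show z = Circle.exp a₀
    rw [e, exp_liftIco]

/-! ### Connected open subsets are arcs -/

/-- **Structure of connected open subsets of `S¹`, relative form**: a [nonempty] connected open `A`
missing the point `exp(ia₀)` is an open arc `exp(i·(c, d))` with `a₀ ≤ c < d ≤ a₀ + 2π`. This is the
fact behind the printed proofs of Lemma 3.2 (ii), (iv)–(ix) ("arc length", pp. 25–26).
[cite: MochizukiFrdII2008, Lem 3.2 p.25] -/
theorem exists_eq_exp_image_Ioo_of_notMem {A : Set Circle} (hA : IsConnected A) (hAo : IsOpen A)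
    {a₀ : ℝ} (hp₀ : Circle.exp a₀ ∉ A) :
    ∃ c d : ℝ, a₀ ≤ c ∧ c < d ∧ d ≤ a₀ + 2 * π ∧ A = Circle.exp '' Ioo c d := by
  set g := liftIco a₀ with hg
  set S := g '' A with hS
  have hSconn : IsConnected S :=
    hA.image g (continuousOn_of_forall_continuousAt fun z hz =>
      continuousAt_liftIco fun e => hp₀ (e ▸ hz))
  have hSsub : S ⊆ Ioo a₀ (a₀ + 2 * π) := by
    rintro _ ⟨z, hz, rfl⟩
    refine ⟨lt_of_le_of_ne (liftIco_mem a₀ z).1 ?_, (liftIco_mem a₀ z).2⟩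
    intro e
    apply hp₀
    rw [e, hg, exp_liftIco]
    exact hz
  have hSopen : IsOpen S := by
    have : S = Ioo a₀ (a₀ + 2 * π) ∩ Circle.exp ⁻¹' A := by
      ext x
      constructor
      · intro hx
        refine ⟨hSsub hx, ?_⟩
        obtain ⟨z, hz, rfl⟩ := hx
        show Circle.exp (g z) ∈ A
        rw [hg, exp_liftIco]
        exact hz
      · rintro ⟨hx, hxA⟩
        exact ⟨Circle.exp x, hxA, liftIco_exp (Ioo_subset_Ico_self hx)⟩
    rw [this]
    exact isOpen_Ioo.inter (hAo.preimage Circle.exp.continuous)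
  have hb : BddBelow S := ⟨a₀, fun x hx => (hSsub hx).1.le⟩
  have ha : BddAbove S := ⟨a₀ + 2 * π, fun x hx => (hSsub hx).2.le⟩
  have hSeq := eq_Ioo_of_isOpen_isConnected hSopen hSconn hb ha
  refine ⟨sInf S, sSup S, le_csInf hSconn.nonempty fun x hx => (hSsub hx).1.le, ?_,
    csSup_le hSconn.nonempty fun x hx => (hSsub hx).2.le, ?_⟩
  · obtain ⟨x, hx⟩ := hSconn.nonempty
    rw [hSeq] at hx
    exact hx.1.trans hx.2
  · rw [← hSeq]
    ext z
    constructor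
    · intro hz
      exact ⟨g z, ⟨z, hz, rfl⟩, exp_liftIco a₀ z⟩
    · rintro ⟨x, ⟨z, hz, rfl⟩, rfl⟩
      rw [hg, exp_liftIco]
      exact hz

/-- **Structure of connected open subsets of `S¹`**: a [nonempty] connected open `A ≠ S¹` is an open
arc `exp(i·(c, d))` with `0 < d - c ≤ 2π` (the case `d - c = 2π` being `S¹` minus a point).
[cite: MochizukiFrdII2008, Lem 3.2 p.25] -/
theorem exists_eq_exp_image_Ioo {A : Set Circle} (hA : IsConnected A) (hAo : IsOpen A)
    (hne : A ≠ univ) : ∃ c d : ℝ, c < d ∧ d - c ≤ 2 * π ∧ A = Circle.exp '' Ioo c d := by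
  obtain ⟨p₀, hp₀⟩ := (ne_univ_iff_exists_notMem A).mp hne
  obtain ⟨a₀, rfl⟩ := Circle.exp_surjective p₀
  obtain ⟨c, d, h₁, h₂, h₃, h₄⟩ := exists_eq_exp_image_Ioo_of_notMem hA hAo hp₀
  exact ⟨c, d, h₂, by linarith, h₄⟩

/-- `exp` is injective on `[a₀, a₀ + 2π)`: images of subsets meet as the subsets do.
[cite: MochizukiFrdII2008, Lem 3.2 p.25] -/
theorem exp_image_inter {a₀ : ℝ} {S T : Set ℝ} (hS : S ⊆ Ico a₀ (a₀ + 2 * π))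
    (hT : T ⊆ Ico a₀ (a₀ + 2 * π)) :
    Circle.exp '' S ∩ Circle.exp '' T = Circle.exp '' (S ∩ T) :=
  ((Circle.exp_injOn_Ico (a := a₀) (b := a₀ + 2 * π) (by linarith)).image_inter hS hT).symm

/-- Arcs `exp(i·(a, b))`, `exp(i·(b', e))` inside one period with `b ≤ b'` are disjoint.
[cite: MochizukiFrdII2008, Lem 3.2 p.25] -/
theorem exp_image_Ioo_inter_eq_empty {a₀ a b b' e : ℝ} (ha : a₀ ≤ a) (hb : b ≤ a₀ + 2 * π)
    (hbb' : b ≤ b') (hb' : a₀ ≤ b') (he : e ≤ a₀ + 2 * π) :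
    Circle.exp '' Ioo a b ∩ Circle.exp '' Ioo b' e = ∅ := by
  rw [exp_image_inter (fun x hx => ⟨ha.trans hx.1.le, hx.2.trans_le hb⟩)
    (fun x hx => ⟨hb'.trans hx.1.le, hx.2.trans_le he⟩)]
  convert image_empty Circle.exp
  exact Set.eq_empty_of_forall_notMem fun x ⟨h1, h2⟩ => by linarith [h1.2, h2.1]

/-! ### Arcs are connected open; their images under translations and `φ_n` -/

/-- `exp` is an open map (it is a covering map). [cite: MochizukiFrdII2008, Lem 3.2 p.25] -/
theorem isOpenMap_exp : IsOpenMap Circle.exp := Circle.isCoveringMap_exp.isLocalHomeomorph.isOpenMap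

/-- An arc `exp(i·U)` of an open `U ⊆ ℝ` is open. [cite: MochizukiFrdII2008, Lem 3.2 p.25] -/
theorem isOpen_exp_image {U : Set ℝ} (hU : IsOpen U) : IsOpen (Circle.exp '' U) := isOpenMap_exp U hU

/-- An open arc `exp(i·(c, d))` with `c < d` is [nonempty] connected.
[cite: MochizukiFrdII2008, Lem 3.2 p.25] -/
theorem isConnected_exp_image_Ioo {c d : ℝ} (h : c < d) : IsConnected (Circle.exp '' Ioo c d) :=
  (isConnected_Ioo h).image _ Circle.exp.continuous.continuousOn

/-- `φ_n(exp(ix)) = exp(i n x)`. [cite: MochizukiFrdII2008, Lem 3.2 p.25] -/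
theorem phi_exp (n : ℤ) (x : ℝ) : phi n (Circle.exp x) = Circle.exp (n * x) := by
  rw [phi, ← Circle.exp_zsmul, zsmul_eq_mul]

/-- `φ_n(exp(i·U)) = exp(i·nU)`. [cite: MochizukiFrdII2008, Lem 3.2 p.25] -/
theorem phi_image_exp_image (n : ℤ) (U : Set ℝ) :
    phi n '' (Circle.exp '' U) = Circle.exp '' ((fun x => (n : ℝ) * x) '' U) := by
  rw [image_image, image_image]
  exact image_congr fun x _ => phi_exp n x

/-- `exp(it) · exp(i·U) = exp(i·(t + U))`. [cite: MochizukiFrdII2008, Lem 3.2 p.25] -/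
theorem exp_smul_exp_image (t : ℝ) (U : Set ℝ) :
    Circle.exp t • (Circle.exp '' U) = Circle.exp '' ((fun x => t + x) '' U) := by
  rw [image_image, ← image_smul, image_image]
  exact image_congr fun x _ => by rw [smul_eq_mul, ← Circle.exp_add]

/-- An open arc of length `> 2π` is all of `S¹`. [cite: MochizukiFrdII2008, Lem 3.2 p.25] -/
theorem exp_image_Ioo_eq_univ {c d : ℝ} (h : 2 * π < d - c) : Circle.exp '' Ioo c d = univ := by
  refine eq_univ_of_forall fun z => ?_
  by_cases hz : z = Circle.exp c
  · exact ⟨c + 2 * π, ⟨by linarith [two_pi_pos], by linarith⟩, by rw [hz, Circle.exp_add_two_pi]⟩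
  · have hmem : z ∈ ({Circle.exp c}ᶜ : Set Circle) := hz
    rw [← exp_image_Ioo_eq_compl] at hmem
    obtain ⟨x, hx, rfl⟩ := hmem
    exact ⟨x, ⟨hx.1, by linarith [hx.2]⟩, rfl⟩

/-- **Arc length is monotone**: if `exp(i·(c₁, d₁)) ⊆ exp(i·(c, d))` with `d - c ≤ 2π`, then
`d₁ - c₁ ≤ d - c` (the lift `x ↦ lift(exp(ix)) - x` is continuous on `(c₁, d₁)` with values in
`2πℤ`, hence constant; this is the "arc length" of the printed proofs, pp. 25–26).
[cite: MochizukiFrdII2008, Lem 3.2 p.25] -/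
theorem sub_le_sub_of_exp_image_Ioo_subset {c₁ d₁ c d : ℝ} (h₁ : c₁ < d₁) (hcd : d - c ≤ 2 * π)
    (hsub : Circle.exp '' Ioo c₁ d₁ ⊆ Circle.exp '' Ioo c d) : d₁ - c₁ ≤ d - c := by
  have hlift : ∀ x ∈ Ioo c₁ d₁, liftIco c (Circle.exp x) ∈ Ioo c d ∧
      ∃ k : ℤ, liftIco c (Circle.exp x) - x = k * (2 * π) := by
    intro x hx
    obtain ⟨y, hy, hxy⟩ := hsub ⟨x, hx, rfl⟩
    have hyI : y ∈ Ico c (c + 2 * π) := ⟨hy.1.le, by linarith [hy.2]⟩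
    have hl : liftIco c (Circle.exp x) = y := by rw [← hxy, liftIco_exp hyI]
    refine ⟨hl ▸ hy, ?_⟩
    obtain ⟨m, hm⟩ := Circle.exp_eq_exp.mp hxy
    exact ⟨m, by rw [hl, hm]; ring⟩
  set F : ℝ → ℝ := fun x => liftIco c (Circle.exp x) - x with hF_def
  have hF : ContinuousOn F (Ioo c₁ d₁) := by
    intro x hx
    refine ContinuousAt.continuousWithinAt (ContinuousAt.sub ?_ continuousAt_id)
    refine (continuousAt_liftIco ?_).comp Circle.exp.continuous.continuousAt
    intro e
    have := (hlift x hx).1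
    rw [e, liftIco_exp ⟨le_rfl, by linarith [two_pi_pos]⟩] at this
    exact lt_irrefl _ this.1
  have hmaps : MapsTo F (Ioo c₁ d₁) (AddSubgroup.zmultiples (2 * π) : Set ℝ) := by
    intro x hx
    obtain ⟨k, hk⟩ := (hlift x hx).2
    exact ⟨k, by show (k : ℤ) • (2 * π) = F x; rw [zsmul_eq_mul]; exact hk.symm⟩
  have hdisc : IsDiscrete (AddSubgroup.zmultiples (2 * π) : Set ℝ) :=
    isDiscrete_iff_discreteTopology.mpr
      (inferInstanceAs (DiscreteTopology (AddSubgroup.zmultiples (2 * π))))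
  obtain ⟨x₀, hx₀⟩ : (Ioo c₁ d₁).Nonempty := nonempty_Ioo.mpr h₁
  have key : ∀ x ∈ Ioo c₁ d₁, x + F x₀ ∈ Ioo c d := by
    intro x hx
    have hc' := isPreconnected_Ioo.constant_of_mapsTo hdisc hF hmaps hx hx₀
    have : liftIco c (Circle.exp x) = x + F x₀ := by rw [← hc']; simp only [hF_def]; ring
    rw [← this]
    exact (hlift x hx).1
  have hlow : c ≤ c₁ + F x₀ := by
    by_contra hlt
    rw [not_le] at hlt
    obtain ⟨x, hx₁, hx₂⟩ := exists_between (lt_min h₁ (show c₁ < c - F x₀ by linarith))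
    have := (key x ⟨hx₁, lt_of_lt_of_le hx₂ (min_le_left _ _)⟩).1
    have := lt_of_lt_of_le hx₂ (min_le_right _ _)
    linarith
  have hup : d₁ + F x₀ ≤ d := by
    by_contra hlt
    rw [not_le] at hlt
    obtain ⟨x, hx₁, hx₂⟩ := exists_between (max_lt h₁ (show d - F x₀ < d₁ by linarith))
    have := (key x ⟨lt_of_le_of_lt (le_max_left _ _) hx₁, hx₂⟩).2
    have := lt_of_le_of_lt (le_max_right _ _) hx₁
    linarith
  linarith

/-- `φ_n` is surjective for `n ≠ 0` (`exp(it) = exp(it/n)ⁿ`). [cite: MochizukiFrdII2008, Lem 3.2 p.25] -/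
theorem phi_surjective {n : ℤ} (hn : n ≠ 0) : Surjective (phi n) := by
  intro z
  obtain ⟨t, rfl⟩ := Circle.exp_surjective z
  refine ⟨Circle.exp (t / n), ?_⟩
  rw [phi_exp, mul_div_cancel₀ _ (Int.cast_ne_zero.mpr hn)]

/-- `φ_n(S¹) = S¹` for `n ≠ 0`. [cite: MochizukiFrdII2008, Lem 3.2 p.25] -/
theorem phi_image_univ {n : ℤ} (hn : n ≠ 0) : phi n '' univ = univ :=
  image_univ_of_surjective (phi_surjective hn)

end CircleOpens

end

end Literature.AlgebraicGeometry.Frobenioids
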